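import Summits.BirchSwinnertonDyer.BirchSwinnertonDyer.Theorems.SignedLowerHalvesKobayashiLowerHalfLargeImageCongruenceShapeCert
import Summits.BirchSwinnertonDyer.BirchSwinnertonDyer.Theorems.Rank1ResidualIntModelReduction
import Summits.BirchSwinnertonDyer.Rank1Residual.X2.LocalDeltaCalculus
import Summits.BirchSwinnertonDyer.Rank1Residual.Supersingular.RankOneSurjThreeCertificates_05
import Summits.BirchSwinnertonDyer.Rank1Residual.Supersingular.RankOneRem13RecordShapesCount
import Summits.BirchSwinnertonDyer.Rank1Residual.Supersingular.RankOneRem13NoCertificate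
import Summits.BirchSwinnertonDyer.Rank1Residual.Supersingular.CountPointsFast
import Summits.BirchSwinnertonDyer.Rank1Residual.GaloisImage.TorsionIsoImageObstruction
import Literature.NumberTheory.EllipticCurves.Fisher2012.HesseFamilyThreeReverseProofs
import Literature.NumberTheory.EllipticCurves.AdditiveReductionSemistableModelProofs
import Literature.NumberTheory.EllipticCurves.IsogenyFrobeniusTraceProofs
import Literature.NumberTheory.EllipticCurves.LFunctionPrimeCoeff
import Literature.NumberTheory.EllipticCurves.OrdinaryPrimesProofs
import HarnessLib

/-!
# Route `SignedLowerHalves`, crux `KobayashiLowerHalfLargeImage` (item stmt-BirchSwinnertonDyer-19001):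
# the congruence road's PLACE TOOLKIT — Greenberg–Vatsal's local term `δ^{(ℓ)} = s_ℓ d_ℓ`
# (`GreenbergVatsal2000.delta`) EVALUATED at the place of `ℚ` over a concrete prime `ℓ` from
# integer-model data (cell `bsd-ssimc`, seat `bsd-ssimc-k3-c3` gen 6; a `--supports
# stmt-BirchSwinnertonDyer-19001 --as helper` file; closes nothing)

PARTITION (cell bsd-ssimc): X7 (A7) × item 3's rank-one window off the tight Mazur–Tate rows — the
kernel bookkeeping every `congl_*` record needs (planner D22-3 C3: "s_ℓ, d_ℓ, Σ₀ and the identity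
l = l_alg KERNEL-DECIDED"). THEOREMS ONLY: no definition, no named fact, nothing about any curve
asserted; BSD is not proved by any of this. No tree file summed `delta W p v` over an explicit finite set
of places before; this file supplies the per-place values:
* `sFactor_eq_of_eq_pow_mul` — `s_ℓ = p^k` from a factorisation `ℓ^{p−1} − 1 = p^{k+1}·m`, `p ∤ m`;
* `natGenerator_symm`, `primesEquiv_symm`, `eq_symm_of_natGenerator_eq`, `natCast_not_mem_symm`,
  `symm_ne_symm` — the place `(primesEquiv).symm ⟨ℓ, _⟩` of `ℚ` over `ℓ` and its prime;
* for a globally minimal `W` with integral model `E₀` (`integralModelInt W = E₀`):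
  `hasGoodReductionAt_of_not_dvd` (`ℓ ∤ Δ(E₀)`), `delta_eq_zero_of_dvd_of_dvd` (additive:
  `ℓ ∣ Δ`, `ℓ ∣ c₄` ⇒ `δ = 0`), `delta_eq_of_split` / `delta_eq_of_nonsplit` (`ℓ ∣ Δ`, `ℓ ∤ c₄`, the
  node-tangent quadratic of `E₀` mod `ℓ` has / has no root ⇒ `δ = s_ℓ·[ℓ ≡ 1]` / `s_ℓ·[ℓ ≡ −1 (mod p)]`),
  `delta_eq_of_good_of_dvd_count` (good `ℓ ∤ 2pΔ` with `p ∣ #Ẽ(𝔽_ℓ)` by `countPoints` ⇒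
  `δ = s_ℓ·(1 + [ℓ ≡ 1 (mod p)])`) — the reduction types by the tree's integer-model certificates
  (`Rank1ResidualIntModelReduction`, Silverman VII.5.1) transported to the place, the values by the
  tree's `X2/LocalDeltaCalculus` (GV Prop. (2.4)).

References: [GreenbergVatsal2000] §2 Prop. (2.4) (p. 22), p. 27; [SilvermanAEC2009] VII.5 Prop. 5.1;
[BDKim2009] Prop. 2.6.
-/

set_option autoImplicit false
set_option linter.dupNamespace false
noncomputable section

open scoped Classical MatrixGroups ModularForm BigOperators

open CongruenceSubgroup WeierstrassCurve NumberField IsDedekindDomain Rat.HeightOneSpectrum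
  Literature.NumberTheory.EllipticCurves
  Literature.NumberTheory.EllipticCurves.ModularForms
  Literature.NumberTheory.EllipticCurves.Rank1Residual
  Literature.NumberTheory.EllipticCurves.Rank1Residual.Typed
  Literature.NumberTheory.EllipticCurves.Kobayashi2003 ZpExtension
  Literature.NumberTheory.EllipticCurves.GreenbergVatsal2000
  Literature.NumberTheory.EllipticCurves.BurungaleKobayashiOta2024
  Literature.NumberTheory.EllipticCurves.Fisher2012
  Literature.NumberTheory.EllipticCurves.Rank1Residual.X11RankOneCertificates
  Literature.NumberTheory.GaloisRepresentations
  Summit.BirchSwinnertonDyer.Rank1Residual.X1.MuLambda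
  Summit.BirchSwinnertonDyer.Rank1Residual.Supersingular
  Summit.BirchSwinnertonDyer.Rank1Residual.X2.LocalDeltaCalculus
  Summit.BirchSwinnertonDyer.BirchSwinnertonDyer.Rank1Residual.IntModel
  Summit.BirchSwinnertonDyer.BirchSwinnertonDyer.Rank1Residual.X11RankOne
  Summit.BirchSwinnertonDyer.Rank1Residual.X11b

namespace Summit.BirchSwinnertonDyer.BirchSwinnertonDyer.Theorems.CongruenceRoad

/-! ### §0 Toolkit: `s_ℓ` and `δ` at a concrete place -/

/-- `s_ℓ = p^k` from a factorisation `ℓ^{p−1} − 1 = p^{k+1}·m`, `p ∤ m`. [cite: GreenbergVatsal2000, §2 Prop. (2.4) (p. 22)] -/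
theorem sFactor_eq_of_eq_pow_mul {p ℓ k m : ℕ} [hp : Fact p.Prime] (h : ℓ ^ (p - 1) - 1 = p ^ (k + 1) * m)
    (hm : ¬ p ∣ m) : sFactor p ℓ = p ^ k := by
  have hm0 : m ≠ 0 := by rintro rfl; exact hm (dvd_zero p)
  unfold sFactor
  rw [h, padicValNat.mul (pow_ne_zero _ hp.out.ne_zero) hm0, padicValNat.prime_pow,
    padicValNat.eq_zero_of_not_dvd hm]
  simp

/-- The place of `ℚ` over a prime `ℓ` has `natGenerator = ℓ`. [folklore] -/
theorem natGenerator_symm (ℓ : ℕ) (hℓ : ℓ.Prime) :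
    natGenerator ((primesEquiv (R := 𝓞 ℚ)).symm ⟨ℓ, hℓ⟩) = ℓ :=
  congrArg Subtype.val ((primesEquiv (R := 𝓞 ℚ)).apply_symm_apply ⟨ℓ, hℓ⟩)

/-- `primesEquiv` of the place over `ℓ`. [folklore] -/
theorem primesEquiv_symm (ℓ : ℕ) (hℓ : ℓ.Prime) :
    primesEquiv ((primesEquiv (R := 𝓞 ℚ)).symm ⟨ℓ, hℓ⟩) = ⟨ℓ, hℓ⟩ :=
  (primesEquiv (R := 𝓞 ℚ)).apply_symm_apply ⟨ℓ, hℓ⟩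

/-- A place whose prime is `ℓ` IS the place over `ℓ`. [folklore] -/
theorem eq_symm_of_natGenerator_eq {v : HeightOneSpectrum (𝓞 ℚ)} {ℓ : ℕ} (hℓ : ℓ.Prime)
    (h : natGenerator v = ℓ) : v = (primesEquiv (R := 𝓞 ℚ)).symm ⟨ℓ, hℓ⟩ := by
  rw [Equiv.eq_symm_apply]
  exact Subtype.ext h

/-- `p ∤ ℓ` for the place over `ℓ ≠ p`: `(p : 𝓞 ℚ) ∉ v_ℓ`. [folklore] -/
theorem natCast_not_mem_symm {p ℓ : ℕ} (hp : p.Prime) (hℓ : ℓ.Prime) (hne : ℓ ≠ p) :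
    ((p : ℕ) : 𝓞 ℚ) ∉ ((primesEquiv (R := 𝓞 ℚ)).symm ⟨ℓ, hℓ⟩).asIdeal := by
  rw [Rat.natCast_mem_asIdeal_iff, natGenerator_symm]
  intro h
  exact hne ((Nat.prime_dvd_prime_iff_eq hℓ hp).mp h)

section Places

variable {W : WeierstrassCurve ℚ} [W.IsElliptic] [W.IsGloballyMinimal] {E₀ : WeierstrassCurve ℤ}
  (hI : integralModelInt W = E₀)

include hI in
omit [W.IsElliptic] in
/-- **Good reduction at the place over `ℓ ∤ Δ(E₀)`.** [cite: SilvermanAEC2009, VII.5 Prop. 5.1(a)] -/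
theorem hasGoodReductionAt_of_not_dvd (v : HeightOneSpectrum (𝓞 ℚ))
    (h : ¬ ((natGenerator v : ℕ) : ℤ) ∣ E₀.Δ) : W.HasGoodReductionAt v := by
  haveI := Fact.mk (primesEquiv v).2
  have hg : W.HasGoodReductionAtPrime (primesEquiv v) :=
    hasGoodReductionAtPrime_of_not_dvd W _ (by rw [minimalDiscriminantInt_eq hI]; exact h)
  exact (hasGoodReductionAtPrime_iff_hasGoodReductionAt_ringOfIntegers v W).mp hg

include hI in
/-- **Additive at the place over `ℓ ∣ Δ(E₀)`, `ℓ ∣ c₄(E₀)`** ⇒ `δ = 0`. [cite: GreenbergVatsal2000, §2 Prop. (2.4) and p. 27] -/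
theorem delta_eq_zero_of_dvd_of_dvd (p : ℕ) [Fact p.Prime] (v : HeightOneSpectrum (𝓞 ℚ))
    (hΔ : ((natGenerator v : ℕ) : ℤ) ∣ E₀.Δ) (hc₄ : ((natGenerator v : ℕ) : ℤ) ∣ E₀.c₄) :
    delta W p v = 0 :=
  delta_of_hasAdditiveReductionAt (hasAdditiveReductionAt_of_dvd_of_dvd W v
    (by rw [minimalDiscriminantInt_eq hI]; exact hΔ) (by rw [hI]; exact hc₄))

include hI in
/-- **Split multiplicative at the place over `ℓ`** (`ℓ ∣ Δ`, `ℓ ∤ c₄`, a root of the node quadratic mod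
`ℓ`) ⇒ `δ = s_ℓ · [ℓ ≡ 1 (mod p)]`. [cite: GreenbergVatsal2000, §2 Prop. (2.4) and p. 27] -/
theorem delta_eq_of_split (p : ℕ) [Fact p.Prime] (v : HeightOneSpectrum (𝓞 ℚ)) (ℓ : ℕ) (hℓ : ℓ.Prime)
    (hvℓ : natGenerator v = ℓ)
    (hΔ : (ℓ : ℤ) ∣ E₀.Δ) (hc₄ : ¬ (ℓ : ℤ) ∣ E₀.c₄)
    (hroot : ∃ t : ZMod ℓ, (E₀.c₄ : ZMod ℓ) * t ^ 2 + (E₀.a₁ * E₀.c₄ : ZMod ℓ) * t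
      - (54 * E₀.b₆ - 3 * E₀.b₂ * E₀.b₄ + E₀.a₂ * E₀.c₄ : ZMod ℓ) = 0) :
    delta W p v = sFactor p ℓ * (if (ℓ : ZMod p) = 1 then 1 else 0) := by
  subst hvℓ
  haveI := Fact.mk (primesEquiv v).2
  have hsplit : W.HasSplitMultiplicativeReductionAt v :=
    (hasSplitMultiplicativeReductionAtPrime_iff_hasSplitMultiplicativeReductionAt W v).mp
      (hasSplitMultiplicativeReductionAtPrime_of_intModel_of_root hI _ hΔ hc₄ hroot)
  rw [delta_eq, dMultiplicity_of_hasSplitMultiplicativeReductionAt hsplit]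

include hI in
/-- **Non-split multiplicative at the place over `ℓ`** (`ℓ ∣ Δ`, `ℓ ∤ c₄`, node quadratic root-free
mod `ℓ`) ⇒ `δ = s_ℓ · [ℓ ≡ −1 (mod p)]`. [cite: GreenbergVatsal2000, §2 Prop. (2.4) and p. 27] -/
theorem delta_eq_of_nonsplit (p : ℕ) [Fact p.Prime] (v : HeightOneSpectrum (𝓞 ℚ)) (ℓ : ℕ) (hℓ : ℓ.Prime)
    (hvℓ : natGenerator v = ℓ)
    (hΔ : (ℓ : ℤ) ∣ E₀.Δ) (hc₄ : ¬ (ℓ : ℤ) ∣ E₀.c₄)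
    (hnoroot : ∀ t : ZMod ℓ, (E₀.c₄ : ZMod ℓ) * t ^ 2 + (E₀.a₁ * E₀.c₄ : ZMod ℓ) * t
      - (54 * E₀.b₆ - 3 * E₀.b₂ * E₀.b₄ + E₀.a₂ * E₀.c₄ : ZMod ℓ) ≠ 0) :
    delta W p v = sFactor p ℓ * (if (ℓ : ZMod p) = -1 then 1 else 0) := by
  subst hvℓ
  haveI := Fact.mk (primesEquiv v).2
  have hmult : W.HasMultiplicativeReductionAt v :=
    W.hasMultiplicativeReductionAt_of_dvd_of_not_dvd v (by rw [minimalDiscriminantInt_eq hI]; exact hΔ)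
      (by rw [hI]; exact hc₄)
  have hns : ¬ W.HasSplitMultiplicativeReductionAt v := fun h ↦
    not_hasSplitMultiplicativeReductionAtPrime_of_intModel_of_noroot hI _ hΔ hc₄ hnoroot
      ((hasSplitMultiplicativeReductionAtPrime_iff_hasSplitMultiplicativeReductionAt W v).mpr h)
  rw [delta_eq, dMultiplicity_of_hasNonsplitMultiplicativeReductionAt hmult hns]

include hI in
/-- **Good at the place over `ℓ ∤ 2pΔ` with `p ∣ #Ẽ(𝔽_ℓ)`** ⇒ `δ = s_ℓ · (1 + [ℓ ≡ 1 (mod p)])`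
(point count by `countPoints`). [cite: GreenbergVatsal2000, §2 Prop. (2.4) and p. 27] -/
theorem delta_eq_of_good_of_dvd_count (p : ℕ) [hp : Fact p.Prime] (v : HeightOneSpectrum (𝓞 ℚ)) (ℓ : ℕ)
    (hℓ : ℓ.Prime) (hvℓ : natGenerator v = ℓ) (hℓ2 : ℓ ≠ 2) (hℓp : ℓ ≠ p) {a1 a2 a3 a4 a6 : ℤ}
    (hE₀ : E₀ = ⟨a1, a2, a3, a4, a6⟩) (hΔ : ¬ (ℓ : ℤ) ∣ discOf [a1, a2, a3, a4, a6]) {n : ℕ}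
    (hc : countPoints [a1, a2, a3, a4, a6] ℓ = n) (hpn : (p : ℤ) ∣ (n : ℤ)) :
    delta W p v = sFactor p ℓ * (if (ℓ : ZMod p) = 1 then 2 else 1) := by
  subst hvℓ hE₀
  haveI := Fact.mk (primesEquiv v).2
  have hΔ' : ¬ ((natGenerator v : ℕ) : ℤ) ∣ (⟨a1, a2, a3, a4, a6⟩ : WeierstrassCurve ℤ).Δ := by
    rw [intCurve_Δ]; exact hΔ
  have hgood : W.HasGoodReductionAt v := hasGoodReductionAt_of_not_dvd hI v hΔ'
  have hcard := natCard_point_eq_of_countPoints a1 a2 a3 a4 a6 (natGenerator v) hℓ2 hΔ hc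
  have htr : W.frobeniusTraceAt v = ((natGenerator v : ℕ) : ℤ) + 1 - n := by
    rw [frobeniusTraceAt_eq_frobeniusTrace]
    change W.frobeniusTrace (natGenerator v) = _
    rw [frobeniusTrace_eq hI hcard]
  have hdvd : (p : ℤ) ∣ ((natGenerator v : ℕ) + 1 - W.frobeniusTraceAt v : ℤ) := by
    rw [htr]; ring_nf; exact hpn
  rw [delta_eq, dMultiplicity_of_hasGoodReductionAt_of_dvd hgood hℓp hdvd]

end Places

/-- Distinct primes give distinct places of `ℚ`. [folklore] -/
theorem symm_ne_symm {ℓ ℓ' : ℕ} (hℓ : ℓ.Prime) (hℓ' : ℓ'.Prime) (hne : ℓ ≠ ℓ') :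
    (primesEquiv (R := 𝓞 ℚ)).symm ⟨ℓ, hℓ⟩ ≠ (primesEquiv (R := 𝓞 ℚ)).symm ⟨ℓ', hℓ'⟩ := fun h ↦
  hne (by simpa using congrArg Subtype.val ((primesEquiv (R := 𝓞 ℚ)).symm.injective h))


end Summit.BirchSwinnertonDyer.BirchSwinnertonDyer.Theorems.CongruenceRoad

end
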